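import Summits.QuantumFields.YangMills.Theorems.BalabanLadderNTBoundaryLawCore
import Literature.MathematicalPhysics.QuantumLattice.LatticeGaugeDLRSpecificationProofs
import Literature.Probability.LatticeModels.GibbsSpecificationDLRProofs
import HarnessLib

/-!
# Crux `NT` (stmt-QuantumFields-19353), stub `stub_cfp : CFP`: the boundary laws only need the CENTRAL SITE of CENTRED cubes

Helper file (`--supports stmt-QuantumFields-19353`) of the fleet lead prover of crux `NT` (unit `ym-spine-19353-p1`,
g2); an unconditional reduction on the ENGINE side of the registered stub `stub_cfp : CFP` (skeleton v2
«conditional-package», b5b471720c374849), sharpening the core form `fbl_of_core` of the sibling file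
`…BoundaryLawCore` (origin-based cubes `[0, b)⁴`, every site of depth `≥ D`).

The femto boundary law `FBL G r a` (conjunct of `CFP`; `Theorems/LangevinControlUVOSLegsFromFemtoAndGapDefs.lean` :136)
quantifies over every femto cube, every exterior and every deep site.  The DLR consistency of the lattice Yang–Mills
specification (`γ_Λ γ_{Λ'} = γ_Λ` for `Λ' ⊆ Λ`; tree `isSpecification_ymSpecification_of_t2Space`, Georgii 2011
Def. 1.23 (iii) / Def. 2.9) removes two of the three quantifiers: the kernel mean of `dens y` in a cube `Q` with
exterior `η` is the `γ_Q(· | η)`-average of the kernel means of `dens y` in the largest sub-cube CENTRED AT `y` that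
fits in `Q` (radius `depth − 1`), whose exteriors are arbitrary; so a bound `|kerE − p β| ≤ C₁/(R+1)⁴` for the CENTRAL
site of every centred cube `[-R, R]⁴` (radius `R`, side `2R+1`, uniformly in the exterior) averages to the same bound
at every site of depth `R + 1` of every cube.  Hence the engine's target for `FBL` is a ONE-parameter family:

* `fbl_of_centred D` — `FBL G r a` follows from: for `β ≥ β₁`, every radius `R ≥ D` with `(2R+1) · a β ≤ ℓ₁` and every
  exterior `η`, `|kerE_{[-R,R]⁴, η} (dens 0) − p β| ≤ C₁ / (R+1)⁴` (any `D`, any `p`, any sign of `C₁`);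
* `fbl6_of_centred D` — `FBL6 G r a` follows from the same statement for the ONE single-plane field of orientation
  `(0, 1)` at the origin.

Tools: `cubeSites_subset`, `cubeEdges_subset` (nested cubes); `isSpecification_cubeKernels` (the cube kernels of a
lattice representation form a specification: `G` is Hausdorff and second countable through `r`);
`kerE_kerE_of_subset` (consistency in kernel-mean form), `abs_kerE_sub_le_of_subset` (a uniform sub-cube bound
averages); `window_of_succ_le_depth`, `centredCube_subset_of_le_depth` (the centred cube of radius `depth − 1` fits);
`kerE_dens_centred_eq`, `kerE_plane_centred_eq` (translation to the origin, sibling `kerE_configShift`).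
-/

set_option autoImplicit false

noncomputable section

open MeasureTheory Filter Topology ProbabilityTheory
open Literature.MathematicalPhysics.QuantumFieldTheory Literature.MathematicalPhysics.QuantumLattice
open Literature.Probability.LatticeModels
open Summit.QuantumFields.YangMills.Cruxes.OSLegsFromFemtoAndGap.DlrCollarTransfer
open Summit.QuantumFields.YangMills.Cruxes.OSLegsFromFemtoAndGap.DlrCollarTransfer.StubLower
  (mem_cubeSites_iff exists_abs_dens_le)

namespace Summit.QuantumFields.YangMills.Cruxes.NT.BoundaryLaw

/-! ## §1 Nested cubes and the centred sub-cube of a deep site -/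

/-- A cube whose coordinate ranges sit inside those of another cube is contained in it. [folklore] -/
theorem cubeSites_subset {c c' : Fin 4 → ℤ} {b b' : ℕ} (h : ∀ j, c j ≤ c' j ∧ c' j + b' ≤ c j + b) :
    cubeSites c' b' ⊆ cubeSites c b := by
  intro z hz
  rw [mem_cubeSites_iff] at hz ⊢
  intro j
  exact ⟨(h j).1.trans (hz j).1, lt_of_lt_of_le (hz j).2 (h j).2⟩

/-- The interior links of a sub-cube are interior links of the cube. [folklore] -/
theorem cubeEdges_subset {c c' : Fin 4 → ℤ} {b b' : ℕ} (h : cubeSites c' b' ⊆ cubeSites c b) :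
    cubeEdges c' b' ⊆ cubeEdges c b := by
  intro e he
  simp only [cubeEdges, Finset.mem_filter, Finset.mem_product, Finset.mem_univ, and_true] at he ⊢
  exact ⟨h he.1, h he.2⟩

/-- A site of depth `≥ n + 1` in the cube `(c, b)` is at least `n` lattice units away from the complement,
coordinatewise: `c j + n ≤ y j` and `y j + n + 1 ≤ c j + b`. [folklore] -/
theorem window_of_succ_le_depth {c : Fin 4 → ℤ} {b : ℕ} {y : Fin 4 → ℤ} {n : ℕ} (hy : n + 1 ≤ depth c b y)
    (j : Fin 4) : c j + n ≤ y j ∧ y j + n + 1 ≤ c j + b := by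
  unfold depth at hy
  have h := (Finset.le_inf'_iff _ _).1 hy j (Finset.mem_univ j)
  rw [le_min_iff] at h
  obtain ⟨h1, h2⟩ := h
  have h1' : (n : ℤ) + 1 ≤ y j - c j + 1 := by
    rcases le_or_gt 0 (y j - c j + 1) with h0 | h0
    · have := Int.toNat_of_nonneg h0; omega
    · have := Int.toNat_eq_zero.2 h0.le; omega
  have h2' : (n : ℤ) + 1 ≤ c j + b - y j := by
    rcases le_or_gt 0 (c j + b - y j) with h0 | h0
    · have := Int.toNat_of_nonneg h0; omega
    · have := Int.toNat_eq_zero.2 h0.le; omega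
  constructor <;> omega

/-- **The centred cube of radius `depth − 1` fits.**  If `y` has depth `≥ R + 1` in the cube `(c, b)`, the cube of
radius `R` centred at `y` (corner `y − R`, side `2R+1`) is contained in it. [folklore] -/
theorem centredCube_subset_of_le_depth {c : Fin 4 → ℤ} {b : ℕ} {y : Fin 4 → ℤ} {R : ℕ}
    (hy : R + 1 ≤ depth c b y) : cubeSites (fun j => y j - R) (2 * R + 1) ⊆ cubeSites c b := by
  refine cubeSites_subset fun j => ?_
  have h := window_of_succ_le_depth hy j
  push_cast at h ⊢
  constructor <;> linarith [h.1, h.2]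

/-- The side of the centred cube of radius `depth − 1` is at most the side of the cube: `2R + 1 ≤ b`. [folklore] -/
theorem two_mul_add_one_le_of_le_depth {c : Fin 4 → ℤ} {b : ℕ} {y : Fin 4 → ℤ} {R : ℕ}
    (hy : R + 1 ≤ depth c b y) : 2 * R + 1 ≤ b := by
  have h := window_of_succ_le_depth hy 0
  omega

/-! ## §2 DLR consistency of the cube kernels, in kernel-mean form -/

section Kernel

variable (G : Type) [Group G] [TopologicalSpace G] [IsTopologicalGroup G] [CompactSpace G]
  [MeasurableSpace G] [BorelSpace G] (r : LatticeRep G)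

/-- **The lattice Yang–Mills kernels of a lattice representation form a specification** (probability, exterior
measurability, properness, consistency): `G` is Hausdorff and second countable through the faithful continuous
matrix representation `r`, so the tree's `isSpecification_ymSpecification_of_t2Space` applies (Georgii 2011, Def. 2.9
with Prop. 2.5). [folklore] -/
theorem isSpecification_cubeKernels (β : ℝ) : IsSpecification (ymSpecification (d := 4) r.ρ β) := by
  haveI := r.t2Space
  haveI := r.secondCountableTopology
  exact isSpecification_ymSpecification_of_t2Space r.ρ r.continuous β

/-- **DLR inside a kernel (consistency in kernel-mean form).**  For nested cubes `Q' ⊆ Q` (interior links of `Q'`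
among those of `Q`), every exterior `η` and every bounded measurable observable `F`: the `Q`-kernel mean of `F` is
the `Q`-kernel mean of the `Q'`-kernel means `U ↦ kerE_{Q', U} F` (Georgii 2011, Def. 1.23 (iii), via Mathlib
`Kernel.integral_comp`). [folklore] -/
theorem kerE_kerE_of_subset (β : ℝ) {c c' : Fin 4 → ℤ} {b b' : ℕ} (hsub : cubeEdges c' b' ⊆ cubeEdges c b)
    (η : LGConfig 4 G) {F : LGConfig 4 G → ℝ} (hF : Measurable F) {M : ℝ} (hM : ∀ U, |F U| ≤ M) :
    kerE G r β c b η (fun U => kerE G r β c' b' U F) = kerE G r β c b η F := by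
  have hγ := isSpecification_cubeKernels G r β
  haveI := hγ.isProbability (cubeEdges c b) η
  unfold kerE
  let κ : Kernel (LGConfig 4 G) (LGConfig 4 G) :=
    ⟨ymSpecification (d := 4) r.ρ β (cubeEdges c' b'), hγ.measurable_fun _⟩
  have hbind : (ymSpecification (d := 4) r.ρ β (cubeEdges c b) η).bind
      (ymSpecification (d := 4) r.ρ β (cubeEdges c' b')) = ymSpecification (d := 4) r.ρ β (cubeEdges c b) η := by
    ext B hB
    rw [Measure.bind_apply hB (hγ.measurable_fun _).aemeasurable]
    exact hγ.consistent hsub η B hB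
  have hcomp : (κ ∘ₖ Kernel.const Unit (ymSpecification (d := 4) r.ρ β (cubeEdges c b) η)) () =
      ymSpecification (d := 4) r.ρ β (cubeEdges c b) η := by
    rw [Kernel.comp_apply, Kernel.const_apply]
    exact hbind
  have hfi : Integrable F ((κ ∘ₖ Kernel.const Unit (ymSpecification (d := 4) r.ρ β (cubeEdges c b) η)) ()) := by
    rw [hcomp]; exact integrable_of_abs_le hF hM
  have key := Kernel.integral_comp hfi
  rw [hcomp, Kernel.const_apply] at key
  exact key.symm

/-- **A uniform sub-cube bound averages.**  If for EVERY exterior `ζ` the `Q'`-kernel mean of a bounded continuous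
observable `F` is within `ε` of `p`, then so is its `Q`-kernel mean for every cube `Q ⊇ Q'` and every exterior
(consistency + the kernels are probability measures; the inner mean is continuous in the exterior by the Feller
property `continuous_integral_ymSpecification`, hence measurable). [folklore] -/
theorem abs_kerE_sub_le_of_subset (β : ℝ) {c c' : Fin 4 → ℤ} {b b' : ℕ} (hsub : cubeEdges c' b' ⊆ cubeEdges c b)
    (η : LGConfig 4 G) {F : LGConfig 4 G → ℝ} (hFc : Continuous F) {M : ℝ} (hM : ∀ U, |F U| ≤ M) {p ε : ℝ}
    (h : ∀ ζ : LGConfig 4 G, |kerE G r β c' b' ζ F - p| ≤ ε) : |kerE G r β c b η F - p| ≤ ε := by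
  haveI := r.secondCountableTopology
  haveI := isProbabilityMeasure_ymSpecification r.ρ r.continuous β (cubeEdges c b) η
  have hg : Continuous fun U => kerE G r β c' b' U F := by
    unfold kerE
    exact continuous_integral_ymSpecification r.ρ r.continuous β (cubeEdges c' b') hFc hM
  have hgM : ∀ U, |kerE G r β c' b' U F| ≤ M := fun U => abs_kerE_le G r β c' b' U hM
  rw [← kerE_kerE_of_subset G r β hsub η hFc.measurable hM]
  unfold kerE at hg hgM h ⊢
  rw [← integral_sub_const_of_abs_le hg.measurable hgM p]
  exact abs_integral_le_of_abs_le h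

/-! ## §3 Translating the centred cube of a site to the origin -/

/-- The kernel mean of `dens y` in the cube of radius `R` centred at `y` with exterior `U` is the kernel mean of
`dens 0` in the cube `[-R, R]⁴` with the translated exterior. [folklore] -/
theorem kerE_dens_centred_eq (β : ℝ) (y : Fin 4 → ℤ) (R : ℕ) (U : LGConfig 4 G) :
    kerE G r β (fun j => y j - R) (2 * R + 1) U (dens G r y) =
      kerE G r β (fun _ => -(R : ℤ)) (2 * R + 1) (configShift (-y) U) (dens G r 0) := by
  have hc : (fun _ => -(R : ℤ)) + y = fun j => y j - R := by funext j; simp; ring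
  have hU : configShift y (configShift (-y) U) = U := by
    rw [configShift_configShift, add_neg_cancel]; funext e; simp
  have key := kerE_dens_configShift G r y β (fun _ => -(R : ℤ)) (2 * R + 1) (configShift (-y) U) 0
  rw [hc, hU, zero_add] at key
  exact key

/-- The same for the single-plane fields. [folklore] -/
theorem kerE_plane_centred_eq (β : ℝ) (q : Fin 4 × Fin 4) (y : Fin 4 → ℤ) (R : ℕ) (U : LGConfig 4 G) :
    kerE G r β (fun j => y j - R) (2 * R + 1) U (plane G r q y) =
      kerE G r β (fun _ => -(R : ℤ)) (2 * R + 1) (configShift (-y) U) (plane G r q 0) := by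
  have hc : (fun _ => -(R : ℤ)) + y = fun j => y j - R := by funext j; simp; ring
  have hU : configShift y (configShift (-y) U) = U := by
    rw [configShift_configShift, add_neg_cancel]; funext e; simp
  have key := kerE_plane_configShift G r y β (fun _ => -(R : ℤ)) (2 * R + 1) (configShift (-y) U) q 0
  rw [hc, hU, zero_add] at key
  exact key

/-! ## §4 The reductions -/

/-- **`FBL` only needs the central site of centred cubes.**  If for some `D` and witnesses `C₁, β₁, ℓ₁, p` the kernel
mean of the action density AT THE ORIGIN in the femto cube `[-R, R]⁴` (`R ≥ D`, `(2R+1) · a β ≤ ℓ₁`, `β ≥ β₁`) is within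
`C₁ / (R+1)⁴` of `p β` for EVERY exterior, then the registered femto boundary law `FBL G r a` holds (any `D`, any
`p`, any sign of `C₁`): at a site `y` of depth `d ≥ D + 1` of an origin-based cube `[0, b)⁴` the centred cube of radius
`d − 1` around `y` fits (`centredCube_subset_of_le_depth`), the cube kernel is the average of its kernels
(`abs_kerE_sub_le_of_subset`), translation moves it to the origin (`kerE_dens_centred_eq`), and `fbl_of_core (D+1)`
finishes. [folklore] -/
theorem fbl_of_centred (a : ℝ → ℝ) (D : ℕ)
    (h : ∃ (C₁ β₁ ℓ₁ : ℝ) (p : ℝ → ℝ), 0 < ℓ₁ ∧ ∀ β : ℝ, β₁ ≤ β → ∀ R : ℕ, D ≤ R →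
      ((2 * R + 1 : ℕ) : ℝ) * a β ≤ ℓ₁ → ∀ η : LGConfig 4 G,
        |kerE G r β (fun _ => -(R : ℤ)) (2 * R + 1) η (dens G r 0) - p β| ≤ C₁ / ((R : ℝ) + 1) ^ 4) :
    FBL G r a := by
  obtain ⟨C₁, β₁, ℓ₁, p, hℓ₁, H⟩ := h
  obtain ⟨M, -, hM⟩ := exists_abs_dens_le G r
  refine fbl_of_core G r a (D + 1) ⟨C₁, β₁, ℓ₁, p, hℓ₁, fun β hβ b hb η y hy => ?_⟩
  -- the centred cube of radius `R = depth − 1` around `y`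
  obtain ⟨R, hR⟩ : ∃ R : ℕ, depth 0 b y = R + 1 := ⟨depth 0 b y - 1, by omega⟩
  have hDR : D ≤ R := by omega
  have hyR : R + 1 ≤ depth 0 b y := hR.ge
  have hsub : cubeEdges (fun j => y j - R) (2 * R + 1) ⊆ cubeEdges 0 b :=
    cubeEdges_subset (centredCube_subset_of_le_depth hyR)
  have hside : ((2 * R + 1 : ℕ) : ℝ) * a β ≤ ℓ₁ := by
    rcases le_or_gt 0 (a β) with ha | ha
    · have h2 : ((2 * R + 1 : ℕ) : ℝ) ≤ (b : ℝ) := by exact_mod_cast two_mul_add_one_le_of_le_depth hyR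
      exact (mul_le_mul_of_nonneg_right h2 ha).trans hb
    · exact (mul_nonpos_iff.2 (Or.inl ⟨by positivity, ha.le⟩)).trans hℓ₁.le
  have hcast : ((depth 0 b y : ℕ) : ℝ) = (R : ℝ) + 1 := by rw [hR]; push_cast; ring
  rw [hcast]
  refine abs_kerE_sub_le_of_subset G r β hsub η (continuous_dens r y) (hM y) fun ζ => ?_
  rw [kerE_dens_centred_eq]
  exact H β hβ R hDR hside _

/-- **`FBL6` only needs the central site of centred cubes, one orientation.**  The registered plane-resolved boundary
law `FBL6 G r a` follows from the same statement for the ONE single-plane field `plane G r (0, 1) 0` at the origin of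
the centred femto cubes `[-R, R]⁴` (then `fbl6_of_core (D+1)`: translations and a coordinate permutation give every
cube, site and orientation). [folklore] -/
theorem fbl6_of_centred (a : ℝ → ℝ) (D : ℕ)
    (h : ∃ (C₁ β₁ ℓ₁ : ℝ) (p : ℝ → ℝ), 0 < ℓ₁ ∧ ∀ β : ℝ, β₁ ≤ β → ∀ R : ℕ, D ≤ R →
      ((2 * R + 1 : ℕ) : ℝ) * a β ≤ ℓ₁ → ∀ η : LGConfig 4 G,
        |kerE G r β (fun _ => -(R : ℤ)) (2 * R + 1) η (plane G r (0, 1) 0) - p β| ≤ C₁ / ((R : ℝ) + 1) ^ 4) :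
    FBL6 G r a := by
  obtain ⟨C₁, β₁, ℓ₁, p, hℓ₁, H⟩ := h
  obtain ⟨M, hM⟩ := exists_abs_plane_le (G := G) r
  refine fbl6_of_core G r a (D + 1) ⟨C₁, β₁, ℓ₁, p, hℓ₁, fun β hβ b hb η y hy => ?_⟩
  obtain ⟨R, hR⟩ : ∃ R : ℕ, depth 0 b y = R + 1 := ⟨depth 0 b y - 1, by omega⟩
  have hDR : D ≤ R := by omega
  have hyR : R + 1 ≤ depth 0 b y := hR.ge
  have hsub : cubeEdges (fun j => y j - R) (2 * R + 1) ⊆ cubeEdges 0 b :=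
    cubeEdges_subset (centredCube_subset_of_le_depth hyR)
  have hside : ((2 * R + 1 : ℕ) : ℝ) * a β ≤ ℓ₁ := by
    rcases le_or_gt 0 (a β) with ha | ha
    · have h2 : ((2 * R + 1 : ℕ) : ℝ) ≤ (b : ℝ) := by exact_mod_cast two_mul_add_one_le_of_le_depth hyR
      exact (mul_le_mul_of_nonneg_right h2 ha).trans hb
    · exact (mul_nonpos_iff.2 (Or.inl ⟨by positivity, ha.le⟩)).trans hℓ₁.le
  have hcast : ((depth 0 b y : ℕ) : ℝ) = (R : ℝ) + 1 := by rw [hR]; push_cast; ring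
  rw [hcast]
  refine abs_kerE_sub_le_of_subset G r β hsub η (continuous_plane r (0, 1) y) (hM (0, 1) y) fun ζ => ?_
  rw [kerE_plane_centred_eq]
  exact H β hβ R hDR hside _

end Kernel

end Summit.QuantumFields.YangMills.Cruxes.NT.BoundaryLaw

end
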